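import Summits.ValiantsHypothesis.ValiantsHypothesis.Theses.BarrierLever
import Summits.ValiantsHypothesis.ValiantsHypothesis.Theorems.BarrierLeverChowHitsThinRowPartitionMinorsRSlices
import Summits.ValiantsHypothesis.ValiantsHypothesis.Theorems.BarrierLeverChowHitsThinRowPartitionMinorsRFullBasis

/-!
# Line `antipodal_gadget` — item stmt-ValiantsHypothesis-21850 `ChowHitsThinRowPartitionMinorsR`
# (thin rows `|u i| ≤ 2`, budget `h·h` affine forms) — REGISTRY v1 (planner valiant-natproofs-p1 g23,
# 2026-08-29)

D-0145 line registry for the rank-9 SUPPORT item 21850 of route-ValiantsHypothesis-BarrierLever (not a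
binder of `closes`; nothing here bears on stmt-14610 / stmt-8745 / `VP ≠ VNP`).  Card:
`Cruxes/ChowHitsThinRowPartitionMinorsR/Lines/antipodal-gadget.md`.

MECHANISM (val-np-p5 g28): the ANTIPODAL GADGET reduction (`ChowThinHH.chowHitsHH_of_gadgetCertificate`,
p687516) removes the x-structure of pair rows; the LABELLED CERTIFICATE (`chowHitsHH_of_labels`, p688801)
then gives the two UNCONDITIONAL ranges used by the composition below:
* `ChowThinHH.chowHitsHH_of_card` (p689058): every thin layout with
  `#singleton rows + h + 2·#pair rows ≤ h·h` is hit, every `h`;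
* `ChowThinHH.chowHitsHH_of_singletonBasis` (p689700): columns with an injective down-closed monomial
  basis containing every singleton (affine defect 0) ⇒ every thin layout on them is hit, every `h`.

RESIDUAL = near-full thin rows (budget inequality fails, i.e. fewer than `h` missing incidences) against
columns of POSITIVE affine defect.  It is cut into two genuine pieces by the number of pair rows
(`ChowThinHH.card_pairRows_le`: at most `C(h,2)`):
* `stub_fullPairs`    — ALL `C(h,2)` pairs are rows (zero pair slack; the `S_h`-symmetric boundary case
  the cell's censuses single out: full thin rows × constant-weight / twin columns);
* `stub_missingPairs` — at least one pair is missing (but fewer than `h` incidences in total).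
Composition of record: `ChowHitsThinRowPartitionMinorsR_of : stub_fullPairs → stub_missingPairs → item`
(kernel-checked below; the two proved ranges enter BY NAME).

CURRENT STATE v1: registered open stubs {stub_fullPairs, stub_missingPairs} (2); numerics of record
(kit, GF(2^61−1), --workitem 21850): h = 4 EXHAUSTIVE 13 037 894 thin layouts 0 dead (j322068,
j322248), h = 5 400 k / h = 6 100 k sampled 0 dead (j322249/50); refuter target = a dead near-full thin
layout at budget `h·h`.
-/

set_option linter.dupNamespace false

namespace Summit.ValiantsHypothesis.ValiantsHypothesis.Cruxes.ChowHitsThinRowPartitionMinorsR.AntipodalGadget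

open Finset MvPolynomial
open Summit.ValiantsHypothesis.ValiantsHypothesis.Theses.BarrierLever
open Summit.ValiantsHypothesis.ValiantsHypothesis.Theorems.BarrierLever

/-- The item's conclusion for one layout `(u, w)` at height `h`: some product of `h·h` affine forms in
the `h + h` variables has a nonsingular partition minor on `(u, w)`. -/
def Hit (h r : ℕ) (u w : Fin r → Finset (Fin h)) : Prop :=
  ∃ ℓ : Fin (h * h) → MvPolynomial (Fin (h + h)) ℂ, (∀ k, (ℓ k).totalDegree ≤ 1) ∧
    (Matrix.of fun i j : Fin r => MvPolynomial.coeff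
      (∑ a ∈ u i, Finsupp.single (Fin.castAdd h a) 1 +
        ∑ c ∈ w j, Finsupp.single (Fin.natAdd h c) 1) (∏ k, ℓ k)).det ≠ 0

/-- Number of singleton rows. -/
def singles {h r : ℕ} (u : Fin r → Finset (Fin h)) : ℕ :=
  (Finset.univ.filter fun i : Fin r => (u i).card = 1).card

/-- Number of pair rows. -/
def pairs {h r : ℕ} (u : Fin r → Finset (Fin h)) : ℕ :=
  (Finset.univ.filter fun i : Fin r => (u i).card = 2).card

/-- POSITIVE AFFINE DEFECT of the column family: there is NO injective down-closed monomial basis of the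
columns (`det [U i ⊆ w j] ≠ 0`) containing every singleton `{c}` — the negation, verbatim, of the
hypothesis of `ChowThinHH.chowHitsHH_of_singletonBasis`. -/
def PosDefect (h r : ℕ) (w : Fin r → Finset (Fin h)) : Prop :=
  ¬ ∃ U : Fin r → Finset (Fin h), Function.Injective U ∧
      (∀ i (S : Finset (Fin h)), S ⊆ U i → ∃ i', U i' = S) ∧
      (Matrix.of fun i j : Fin r => if U i ⊆ w j then (1 : ℂ) else 0).det ≠ 0 ∧
      (∀ c : Fin h, ∃ i, U i = {c})

/-- NODE A (text). Near-full thin layouts whose rows contain ALL `C(h,2)` pairs, against columns of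
positive affine defect, are hit by `h·h` affine forms for all large `h`. -/
def Stmt.stub_fullPairs : Prop :=
  ∃ h₀ : ℕ, ∀ h : ℕ, h₀ ≤ h → ∀ (r : ℕ) (u w : Fin r → Finset (Fin h)),
    Function.Injective u → Function.Injective w → (∀ i, (u i).card ≤ 2) →
    h * h < singles u + h + 2 * pairs u → pairs u = h.choose 2 → PosDefect h r w → Hit h r u w

/-- NODE B (text). Near-full thin layouts (fewer than `h` missing incidences) with AT LEAST ONE missing
pair, against columns of positive affine defect, are hit by `h·h` affine forms for all large `h`. -/
def Stmt.stub_missingPairs : Prop :=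
  ∃ h₀ : ℕ, ∀ h : ℕ, h₀ ≤ h → ∀ (r : ℕ) (u w : Fin r → Finset (Fin h)),
    Function.Injective u → Function.Injective w → (∀ i, (u i).card ≤ 2) →
    h * h < singles u + h + 2 * pairs u → pairs u < h.choose 2 → PosDefect h r w → Hit h r u w

/-- registered stub A (open). -/
theorem stub_fullPairs : Stmt.stub_fullPairs := by
  sorry

/-- registered stub B (open). -/
theorem stub_missingPairs : Stmt.stub_missingPairs := by
  sorry

/-- The proved range «few incidences» (`chowHitsHH_of_card`, p689058) in the line's vocabulary. -/
theorem hit_of_budget (h r : ℕ) (u w : Fin r → Finset (Fin h))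
    (hu : Function.Injective u) (hw : Function.Injective w) (hu2 : ∀ i, (u i).card ≤ 2)
    (hb : singles u + h + 2 * pairs u ≤ h * h) : Hit h r u w :=
  ChowThinHH.chowHitsHH_of_card h r u w hu hw hu2 hb

/-- The proved range «affine defect 0» (`chowHitsHH_of_singletonBasis`, p689700) in the line's
vocabulary. -/
theorem hit_of_not_posDefect (h r : ℕ) (u w : Fin r → Finset (Fin h))
    (hu : Function.Injective u) (hu2 : ∀ i, (u i).card ≤ 2) (hd : ¬ PosDefect h r w) :
    Hit h r u w := by
  classical
  obtain ⟨U, hUinj, hUdown, hZ, hUsing⟩ := not_not.mp hd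
  exact ChowThinHH.chowHitsHH_of_singletonBasis h r u w hu hu2 U hUinj hUdown hZ hUsing

/-- **Composition of record (v1).** The two residual nodes imply item 21850; the complementary ranges
enter by name (`chowHitsHH_of_card`, `chowHitsHH_of_singletonBasis`, `card_pairRows_le`). -/
theorem ChowHitsThinRowPartitionMinorsR_of :
    Stmt.stub_fullPairs → Stmt.stub_missingPairs → ChowHitsThinRowPartitionMinorsR := by
  classical
  rintro ⟨hA, HA⟩ ⟨hB, HB⟩
  refine ⟨max hA hB, fun h hh r u w hu hw hu2 => ?_⟩
  show Hit h r u w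
  by_cases hb : singles u + h + 2 * pairs u ≤ h * h
  · exact hit_of_budget h r u w hu hw hu2 hb
  by_cases hd : PosDefect h r w
  · have hle : pairs u ≤ h.choose 2 := ChowThinHH.card_pairRows_le u hu
    rcases Nat.lt_or_ge (pairs u) (h.choose 2) with hlt | hge
    · exact HB h ((le_max_right _ _).trans hh) r u w hu hw hu2 (Nat.lt_of_not_le hb) hlt hd
    · exact HA h ((le_max_left _ _).trans hh) r u w hu hw hu2 (Nat.lt_of_not_le hb)
        (le_antisymm hle hge) hd
  · exact hit_of_not_posDefect h r u w hu hu2 hd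

end Summit.ValiantsHypothesis.ValiantsHypothesis.Cruxes.ChowHitsThinRowPartitionMinorsR.AntipodalGadget
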